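import Summits.BirchSwinnertonDyer.BirchSwinnertonDyer.Theses.ErratumRoadFive
import Summits.BirchSwinnertonDyer.BirchSwinnertonDyer.Theorems.ErratumRoadFiveEulerHalfNotRamRung129360cy1Image
import Summits.BirchSwinnertonDyer.BirchSwinnertonDyer.Theorems.ErratumRoadFiveEulerHalfNotRamInertUpToOneTwo
import Summits.BirchSwinnertonDyer.BirchSwinnertonDyer.Theorems.ErratumRoadFiveEulerHalfNotRamInertSavedOfCarrierLabels
import Summits.BirchSwinnertonDyer.BirchSwinnertonDyer.Theorems.ClassRecordThreeEulerHalvesAtThreePoitouTateOfCanonical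
import Literature.NumberTheory.EllipticCurves.QuadraticTwistLocalDataAtTwoHoldsProofs
import HarnessLib

/-!
# Route `ErratumRoadFive`, crux `EulerHalfNotRamNoInertSetAtFive` (item stmt-BirchSwinnertonDyer-19715), line `birth` —
# (129360cy1, 5): THE RUNG WITH ONE PER-PAIR INPUT, the analytic rank `r_an(E) = 1`

Cell `bsd-stepL`, seat `bsd-line-er5-p1-w3` (D-0154 extra width seat on crux 19715, lead `bsd-line-er5-p1`), `--supports stmt-BirchSwinnertonDyer-19715`.
THEOREMS ONLY, ONE curve: `E = [0,1,0,−615785,185776275]` = Cremona **129360cy1** (`N = 2⁴·3·5·7²·11`). Fourth file of the kernel rung at the ONE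
census pair of line `birth`'s up-to-one road: `…Rung129360cy1LocalData` (p627895: split carriers `3, 5, 11`, `¬ Ram`, `5 ∣ ∏c`, no inert set, no
split-set datum, the up-to-one₂ datum `q₁ = 11`, `S = {3,5}`, `R = {5}`), `…Rung129360cy1UpToOne` (p628693: the rung modulo the route items + ONE
typed display, binder `ClassX11b E 5`), `…Rung129360cy1Image` (route-free: `Surj E 5` by Serre's witnesses `13, 23, 23`, `Irr E 5`,
`ClassX11b E 5 ↔ E.analyticRank = 1`). HERE the class predicate is discharged down to the analytic rank inside the rung — the same two road calls as
`…UpToOne` (-w2's pair-level up-to-one₂ road p624790 §1 at the kernel datum; the display either a binder `ShimuraInertSavedDisplayAtD E 5 11` or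
DERIVED as the registered skeleton does from `ShimuraCasselsTateLevelInputs` + `stub_printFactsHeld`.2 + the REGISTERED text of
`stub_shimuraCarrierLabelsB6AtFive`, -w2 p624474 + tam3-p1's Poitou–Tate-of-canonical), written against the route items directly so that this file
sits at depth one of the route's import cone.

RESULT: at (129360cy1, 5) the Euler-system half `Typed.MissingUpperBoundAt E 5` is a kernel theorem modulo EXACTLY {route items `PublishedInputsFive`,
`X11aLowerHalf`, `ShimuraParametrizationDataNonempty`, `PastenComponentOrdersInput` (+ `ShimuraCasselsTateLevelInputs` in the second form), the typed
display ∕ (`stub_printFactsHeld`.2 + `stub_shimuraCarrierLabelsB6AtFive`), and the ONE per-pair input `E.analyticRank = 1`} — every other hypothesis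
of the crux's text at this pair (`5 ≤ 5`, `Surj`, `¬ Ram`, `5 ∣ ∏c`, «no inert datum», and `Mult`∕`Irr` inside `ClassX11b`) is a kernel theorem
(`Rung129360cy1.mem_crux_of_analyticRank`).

HONEST FRAMING: CONDITIONAL on the items (OPEN: `X11aLowerHalf`; typed-not-proved: the printed inputs, `casselsTate_levelInputs`, the (B6)-labelled CM
family) and on `r_an(E) = 1` (Cremona: `r = 1`; not certifiable in the tree today); a helper `--supports` 19715, not a closure; BSD(129360cy1, 5) is
NOT proved by this; nothing is booked; no summit statement is touched; no definition, no named fact, no `sorry`, no kit.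

References: [Cremona1997] Table 1 ∕ ecdata (curve 129360cy1); [Serre1972] §2.8 Prop. 19; [Jetchev2008] Thm. 1.1, Cor. 1.5; [Kim2022HigherGZ] Rem. 7.9;
[PastenShimura2024] §6.6, Lemma 6.18; [PapikianRabinoff2016] Cor. 3.5; [MilneADT2006] Ch. I Thm. 4.10(b); [GrossZagier1986Heegner] III (3.1).
-/

noncomputable section

open scoped Classical NumberField

open WeierstrassCurve NumberField IsDedekindDomain Literature.NumberTheory.EllipticCurves
  Literature.NumberTheory.EllipticCurves.Rank1Residual
  Literature.NumberTheory.EllipticCurves.Rank1Residual.Typed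
  Summit.BirchSwinnertonDyer.Rank1Residual Summit.BirchSwinnertonDyer.Rank1Residual.X11b
  Summit.BirchSwinnertonDyer.BirchSwinnertonDyer.Rank1Residual
  Summit.BirchSwinnertonDyer.BirchSwinnertonDyer.Theses.ErratumRoadFive

-- the cell's Theorems namespace repeats the summit name (Summit.<Summit>.<Problem>), as in every sibling file
set_option linter.dupNamespace false

namespace Summit.BirchSwinnertonDyer.BirchSwinnertonDyer.Theorems.EulerHalfInertUpToOne.Rung129360cy1

/-! ### §6 The rung with ONE per-pair input: the analytic rank -/

/-- **`r_an(E) = 1` ⟹ `Typed.MissingUpperBoundAt E 5` for `E` = 129360cy1, GIVEN the route items `PublishedInputsFive` (GZK, modularity, newform,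
Friedberg–Hoffstein, Mazur), `X11aLowerHalf`, `ShimuraParametrizationDataNonempty`, `PastenComponentOrdersInput` and the ONE typed display
`Theorems.ShimuraInertSavedDisplayAtD E 5 11`** — -w2's pair-level up-to-one₂ road (p624790 §1) at the kernel datum `upToOneDatum₂_eleven` with the kernel
facts `split_eleven`, `not_ram_five` and the class predicate assembled from `r_an = 1`, `mult_five`, `irr_five` (`classX11b_five_iff_analyticRank`); Barrios
et al.'s `c₂` fact is the tree theorem `…two_mem_of_goodReduction_holds`. CONDITIONAL on the items and the display; nothing booked.
[cite: Jetchev2008, Thm. 1.1, Cor. 1.5] [cite: PastenShimura2024, §6.6, Lemma 6.18] [cite: Serre1972, §2.8 Prop. 19] [cite: Cremona1997, Table 1 (curve 129360cy1)] -/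
theorem missingUpperBoundAt_of_analyticRank_of_items_of_savedDisplayAtD (h₅ : PublishedInputsFive) (h₃ : X11aLowerHalf)
    (hJL : ShimuraParametrizationDataNonempty) (hCO : PastenComponentOrdersInput)
    [Fact (Nat.Prime 5)] [Fact (Nat.Prime 11)] [((⟨0, 1, 0, -615785, 185776275⟩ : WeierstrassCurve ℤ).baseChange ℚ).IsElliptic] [((⟨0, 1, 0, -615785, 185776275⟩ : WeierstrassCurve ℤ).baseChange ℚ).IsGloballyMinimal]
    (hr : ((⟨0, 1, 0, -615785, 185776275⟩ : WeierstrassCurve ℤ).baseChange ℚ).analyticRank = 1) (hSavD : ShimuraInertSavedDisplayAtD ((⟨0, 1, 0, -615785, 185776275⟩ : WeierstrassCurve ℤ).baseChange ℚ) 5 11) :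
    Typed.MissingUpperBoundAt ((⟨0, 1, 0, -615785, 185776275⟩ : WeierstrassCurve ℤ).baseChange ℚ) 5 := by
  obtain ⟨-, -, -, -, -, hGZK, hmod, hnf, -, -, hMaz, -, hFH, -, -⟩ := h₅
  exact missingUpperBoundAt_of_classX11b_of_not_ram_of_upToOne₂_of_savedDisplayD hGZK hmod hnf hFH hMaz
    Literature.NumberTheory.EllipticCurves.BarriosEtAl2025.localTamagawaNumber_quadraticTwist_two_mem_of_goodReduction_holds hJL hCO
    ((⟨0, 1, 0, -615785, 185776275⟩ : WeierstrassCurve ℤ).baseChange ℚ) 5 (classX11b_five_iff_analyticRank.mpr hr) le_rfl not_ram_five (fun Wd _ _ hXa ↦ h₃ Wd 5 hXa) 11 split_eleven hSavD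
    upToOneDatum₂_eleven

/-- **`r_an(E) = 1` ⟹ `Typed.MissingUpperBoundAt E 5` for `E` = 129360cy1 modulo the REGISTERED texts** — the five route items `PublishedInputsFive`,
`X11aLowerHalf`, `ShimuraParametrizationDataNonempty`, `PastenComponentOrdersInput`, `ShimuraCasselsTateLevelInputs`, conjunct (2) of the CITABLE stub
`stub_printFactsHeld` (SelmerComplement of THE canonical invariant maps ⟹ Poitou–Tate, tam3-p1's `Koly.poitouTate_conj_forall_of_selmerComplement_canonical`)
and the registered typed stub `stub_shimuraCarrierLabelsB6AtFive` (its TEXT VERBATIM as `hLabT`; the display at `q₁ = 11` by -w2's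
`shimuraInertSavedDisplayAtD_of_carrierLabelsB6_of_five_le`, p624474). So at this pair the crux's conclusion is a kernel theorem modulo exactly {route
items, `stub_printFactsHeld`.2, `stub_shimuraCarrierLabelsB6AtFive`, `r_an(E) = 1`}. CONDITIONAL; nothing booked; BSD(129360cy1, 5) is NOT proved by this.
[cite: MilneADT2006, Ch. I Prop. 3.8, Thm. 4.10(b)] [cite: Jetchev2008, Thm. 1.1, Cor. 1.5] [cite: Serre1972, §2.8 Prop. 19] [cite: Cremona1997, Table 1 (curve 129360cy1)] -/
theorem missingUpperBoundAt_of_analyticRank_of_items_of_carrierLabelsB6 (h₅ : PublishedInputsFive) (h₃ : X11aLowerHalf)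
    (hJL : ShimuraParametrizationDataNonempty) (hCO : PastenComponentOrdersInput) (hCTi : ShimuraCasselsTateLevelInputs)
    (hSC : ∀ (K : Type) [Field K] [NumberField K] (n : ℕ) [NeZero n],
      (Literature.NumberTheory.GaloisCohomology.LocalInvariants.canonical K n).SelmerComplement)
    (hLabT : ∀ (W : WeierstrassCurve ℚ) [W.IsElliptic] [W.IsGloballyMinimal] (p : ℕ) [Fact p.Prime],
      Summit.BirchSwinnertonDyer.Rank1Residual.ClassX11b W p → 5 ≤ p →
      ∀ (N : ℕ) [NeZero N] (K : Type) [Field K] [NumberField K] (S : Finset ℕ)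
        (Dt : Literature.NumberTheory.EllipticCurves.ModularForms.ModularParametrizationData W N)
        (X : Literature.NumberTheory.Automorphic.ShimuraCurveData (∏ q ∈ S, q) (N / ∏ q ∈ S, q)) (W' : WeierstrassCurve ℚ) [W'.IsElliptic]
        (P₀ : Literature.NumberTheory.Automorphic.ShimuraParametrizationData X W'),
        W.conductorNorm ℤ = N → Literature.NumberTheory.EllipticCurves.IsImaginaryQuadratic K → NumberField.discr K < -4 → Even S.card →
        (∀ ℓ ∈ S, ℓ.Prime ∧ ℓ ∣ N ∧ ¬ ℓ ^ 2 ∣ N ∧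
          ((Ideal.span {(ℓ : ℤ)}).primesOver (NumberField.RingOfIntegers K)).ncard = 1 ∧ ¬ (ℓ : ℤ) ∣ NumberField.discr K) →
        (∀ ℓ : ℕ, ℓ.Prime → ℓ ∣ N → ℓ ∉ S → ((Ideal.span {(ℓ : ℤ)}).primesOver (NumberField.RingOfIntegers K)).ncard = 2) →
        p ∈ S → ¬ (p : ℤ) ∣ Dt.c → P₀.IsMinimalFor W →
        ∃ (ι : K →+* ℂ) (y : (W.baseChange K).toAffine.Point) (degy : ℕ)
          (ys : (m : ℕ) → (W.baseChange (Literature.NumberTheory.EllipticCurves.ringClassField K ι m)).toAffine.Point) (ε : ℤ), 0 < degy ∧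
          padicValNat p degy = padicValNat p P₀.deg ∧
          Literature.NumberTheory.EllipticCurves.LDerivEK W K = 8 * (Real.pi : ℂ) ^ 2 *
              Literature.NumberTheory.EllipticCurves.ModularForms.peterssonProduct (CongruenceSubgroup.Gamma0 N) 2 Dt.f Dt.f /
              ((((NumberField.Units.torsionOrder K : ℝ) / 2) ^ 2 * √|(NumberField.discr K : ℝ)| : ℝ) : ℂ) *
            ((y.canonicalHeight : ℂ) / (degy : ℂ)) ∧
          (¬ IsOfFinAddOrder y → 0 < (AddSubgroup.zmultiples y).index) ∧
          Summit.BirchSwinnertonDyer.BirchSwinnertonDyer.Theorems.ShimuraWalk.LabelsAt W N K ι y ys ε ∧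
          ∀ (q : ℕ) [Fact q.Prime], q ∣ N → q ∉ S → p ∣ (W.baseChange ℚ_[q]).localTamagawaNumber ℤ_[q] →
            Literature.NumberTheory.EllipticCurves.ShimuraCMFamily.LabelB6 ι W N {q} ys)
    [Fact (Nat.Prime 5)] [((⟨0, 1, 0, -615785, 185776275⟩ : WeierstrassCurve ℤ).baseChange ℚ).IsElliptic] [((⟨0, 1, 0, -615785, 185776275⟩ : WeierstrassCurve ℤ).baseChange ℚ).IsGloballyMinimal] (hr : ((⟨0, 1, 0, -615785, 185776275⟩ : WeierstrassCurve ℤ).baseChange ℚ).analyticRank = 1) :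
    Typed.MissingUpperBoundAt ((⟨0, 1, 0, -615785, 185776275⟩ : WeierstrassCurve ℤ).baseChange ℚ) 5 := by
  haveI : Fact (Nat.Prime 11) := ⟨by norm_num⟩
  exact missingUpperBoundAt_of_analyticRank_of_items_of_savedDisplayAtD h₅ h₃ hJL hCO hr
    (shimuraInertSavedDisplayAtD_of_carrierLabelsB6_of_five_le
      (Summit.BirchSwinnertonDyer.Rank1Residual.X11b.Three.Koly.poitouTate_conj_forall_of_selmerComplement_canonical hSC) hCTi hLabT
      ((⟨0, 1, 0, -615785, 185776275⟩ : WeierstrassCurve ℤ).baseChange ℚ) 5 (classX11b_five_iff_analyticRank.mpr hr) le_rfl 11)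

/-- **The crux's text at (129360cy1, 5) from `r_an(E) = 1`-free inputs — all binders but the class predicate DISCHARGED**: given the route items and
the typed display at `q₁ = 11`, `E.analyticRank = 1 → Typed.MissingUpperBoundAt E 5`; the crux's other five binders at this pair are theorems
(`mem_crux_of_analyticRank`), so nothing else is assumed about the pair. CONDITIONAL on the items; nothing booked. [cite: Cremona1997, Table 1 (curve 129360cy1)] -/
theorem rung_res_129360cy1_of_analyticRank_of_items_of_savedDisplayAtD (h₅ : PublishedInputsFive) (h₃ : X11aLowerHalf)
    (hJL : ShimuraParametrizationDataNonempty) (hCO : PastenComponentOrdersInput)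
    [Fact (Nat.Prime 5)] [Fact (Nat.Prime 11)] [((⟨0, 1, 0, -615785, 185776275⟩ : WeierstrassCurve ℤ).baseChange ℚ).IsElliptic] [((⟨0, 1, 0, -615785, 185776275⟩ : WeierstrassCurve ℤ).baseChange ℚ).IsGloballyMinimal]
    (hSavD : ShimuraInertSavedDisplayAtD ((⟨0, 1, 0, -615785, 185776275⟩ : WeierstrassCurve ℤ).baseChange ℚ) 5 11) :
    ((⟨0, 1, 0, -615785, 185776275⟩ : WeierstrassCurve ℤ).baseChange ℚ).analyticRank = 1 → Typed.MissingUpperBoundAt ((⟨0, 1, 0, -615785, 185776275⟩ : WeierstrassCurve ℤ).baseChange ℚ) 5 :=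
  fun hr ↦ missingUpperBoundAt_of_analyticRank_of_items_of_savedDisplayAtD h₅ h₃ hJL hCO hr hSavD

end Summit.BirchSwinnertonDyer.BirchSwinnertonDyer.Theorems.EulerHalfInertUpToOne.Rung129360cy1

end
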